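import Literature.AnabelianGeometry.EtaleTheta.ThetaRigidityToy
import HarnessLib

/-!
# [EtTh] §2 rigidity statements over the interface `RigidData`: the named `Prop`s are SCHEMAS
# (instance-only facts) — kernel witnesses

`Literature/AnabelianGeometry/EtaleTheta/ThetaRigidity.lean` (cell `abc-iut`, seat abc-iut-L2-t2) types
S. Mochizuki, *The Étale Theta Function …* [EtTh] §2 — Prop. 2.12 (i)(ii), Prop. 2.14 (i)–(iii),
Cor. 2.18 (i)–(iv), Cor. 2.19 (i) (PRIMS text pp. 45–65) — as `Prop`-valued definitions over the
lawless interface `RigidData N l`.  Each is a SCHEMA: meaningful — and, by the lane-C2 discharges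
`Discharge/Sec2Cor218iModel`, `Sec2Cor218ivAllLevels`, `Sec2DiscreteRigidity*`, … PROVED modulo named
inputs — AT THE MODEL built from a theta setting, but FALSE as the universally closed statement
`∀ N l (R : RigidData N l), R.<Decl>`.  This file records the latter in the kernel at the explicit
inhabitant `RigidData.Toy.toy` (`ThetaRigidityToy.lean`: level `N = 1`, `Π^tp_X = ℤ × (ℤ/2)³` discrete
abelian, `G_K = μ_1 = 1`, `D_Y = 1`), for the cell's FROZEN FACT-LIST bookkeeping — the rows are
consumable AT A NAMED INSTANCE `R` only, never as `∀ R`: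

| FACT row | decl | witness |
|---|---|---|
| F-0620 | `Cor218_i` | `not_forall_cor218_i` (`id × swap(a,b)` moves `Π^tp_Ÿ`) |
| F-0622 | `Cor218_iii_PiX` | `not_forall_cor218_iii_PiX` (abelian `Π^tp_X`) |
| F-0623 | `Cor218_iii_quotient` | `not_forall_cor218_iii_quotient` (abelian envelope) |
| F-0625 | `Cor218_iv_surjective` | `not_forall_cor218_iv_surjective` |
| F-0626 | `Cor219_i_splittings` | `not_forall_cor219_i_splittings` (`swap(b,c)` moves `s^alg(l·Δ_Θ)`) |
| F-0627 | `Cor219_i_subquotients` | `not_forall_cor219_i_subquotients` |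
| F-1920 | `Prop212_i` | `not_forall_prop212_i` |
| F-0630 | `Prop212_ii` | `not_forall_prop212_ii` |
| F-0631 | `Prop214_i` | `not_forall_prop214_i` (`D_Y = 1`) |
| F-0634 | `Prop214_iii_mono` | `not_forall_prop214_iii_mono` (cusp labels) |
| F-0633 | `Prop214_iii_bi` | `not_forall_prop214_iii_bi` |
| F-0619 | `ActsOnCuspsBy` (predicate) | `not_forall_actsOnCuspsBy` |
| F-0628 | `Induces` (predicate) | `not_forall_induces` |
| F-0629 | `MuConj` (predicate) | `not_forall_muConj` |

What a refutation here MEANS: only the logical shape of the interface row; nothing about [EtTh]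
(a refereed paper) nor about the model instances of lane C2.  Rows F-0621 `Cor218_ii`, F-0624
`Cor218_iv_fibre`, F-0632 `Prop214_ii` HOLD at this toy and are not treated here.  Written by the cell
`abc-iut` (seat abc-iut-w5-d175, F-TRANCHES 146–149/183 of D-0078 (S1)).  No bearing on [IUTchIII]
Cor. 3.12; no side taken; typed ≠ proved.  Proof-only file: no definitions, no instances.

## References

* [MochizukiEtTh2009] S. Mochizuki, *The étale theta function and its Frobenioid-theoretic
  manifestations*, Publ. RIMS 45 (2009): Prop. 2.12 p.45, Prop. 2.14 p.49, Cor. 2.18 pp.59–62,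
  Cor. 2.19 p.64 (PRIMS text pages).
-/

namespace Literature.AnabelianGeometry.EtaleTheta

namespace RigidData

namespace Toy

/-! ## §1. Consistency of the interface; the automorphism `isoBC` of the model environment -/

/-- The interface `RigidData 1 l` is inhabited: the schema rows are refuted by a MODEL of the
interface, not by an inconsistency. [cite: MochizukiEtTh2009, Cor 2.18 p.59] -/
theorem nonempty_rigidData (l : ℕ) : Nonempty (RigidData.{0} 1 l) := ⟨toy l⟩

/-- **An automorphism of the model mono-theta environment of the toy** whose underlying automorphism
of the envelope is `autEnv swapBC` (swap of the `b`- and `c`-coordinates): it preserves `D_Y = 1` and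
the `μ_1`-conjugacy class `{Im s^Θ_Ÿ}`. [cite: MochizukiEtTh2009, Def 2.13(ii) p.48] -/
theorem exists_isoBC :
    ∃ α : ((toy 1).modelMono (one_mem_thetaCocycles 1)).Iso ((toy 1).modelMono (one_mem_thetaCocycles 1)),
      α.e = autEnv swapBC :=
  ⟨{ e := autEnv swapBC
     map_D := by
       change (toy 1).DY.map _ = (toy 1).DY
       rw [DY_eq_bot, Subgroup.map_bot]
     map_sTheta := by
       change (fun H => H.map (autEnv swapBC).toMulEquiv.toMonoidHom) ''
           CycEnvelope.muConjClass _ _ ((toy 1).toThetaEnvData.sTheta (one_mem_thetaCocycles 1)).range =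
         CycEnvelope.muConjClass _ _ ((toy 1).toThetaEnvData.sTheta (one_mem_thetaCocycles 1)).range
       rw [muConjClass_eq_singleton, Set.image_singleton,
         map_autEnv_range_sTheta swapBC (fun _ => rfl) (fun _ => rfl)] }, rfl⟩

/-- `autEnv swapBC` moves `s^alg(xc)` to `s^alg(xb)`. [cite: MochizukiEtTh2009, Def 2.13(ii) p.48] -/
theorem autEnv_swapBC_sAlg_xc :
    autEnv swapBC ((toy 1).toThetaEnvData.sAlg ⟨xc, xc_mem_PiYdd⟩) =
      (toy 1).toThetaEnvData.sAlg ⟨xb, xb_mem_PiYdd⟩ :=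
  SemidirectProduct.ext (Subsingleton.elim _ _) (Subtype.ext rfl)

/-- `s^alg(x) ≠ 1` for `x ≠ 1`. [cite: MochizukiEtTh2009, Def 2.13(i) p.47] -/
theorem sAlg_ne_one {x : P} (hx : x ∈ PiYdd) (h1 : x ≠ 1) :
    (toy 1).toThetaEnvData.sAlg ⟨x, hx⟩ ≠ 1 := fun h =>
  h1 (by
    have h' := congrArg prP h
    rw [prP_sAlg] at h'
    exact h')

/-- Membership in `s^alg_Ÿ(H ∩ Π^tp_Ÿ)` forces membership of the projection in `H`.
[cite: MochizukiEtTh2009, Prop 2.14(i) p.49] -/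
theorem mem_of_sAlg_mem_algImage {H : Subgroup P} {x : P} (hx : x ∈ PiYdd)
    (h : (toy 1).toThetaEnvData.sAlg ⟨x, hx⟩ ∈ (toy 1).algImage H) : x ∈ H := by
  obtain ⟨y, hy, hyx⟩ := h
  have hy' : (y : P) ∈ H := Subgroup.mem_subgroupOf.mp hy
  have h' := congrArg prP hyx
  rw [prP_sAlg, prP_sAlg] at h'
  rw [h'] at hy'
  exact hy'

/-- The image `s^alg_Ÿ((l·Δ_Θ) ∩ Π^tp_Ÿ)` is NOT stable under `autEnv swapBC`.
[cite: MochizukiEtTh2009, Cor 2.19(i) p.64] -/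
theorem map_autEnv_swapBC_algImage_L_ne :
    ((toy 1).algImage (toy 1).lDeltaTheta).map (autEnv swapBC).toMulEquiv.toMonoidHom ≠
      (toy 1).algImage (toy 1).lDeltaTheta := by
  intro h
  have hx : autEnv swapBC ((toy 1).toThetaEnvData.sAlg ⟨xc, xc_mem_PiYdd⟩) ∈
      ((toy 1).algImage (toy 1).lDeltaTheta).map (autEnv swapBC).toMulEquiv.toMonoidHom :=
    Subgroup.mem_map_of_mem _ ⟨⟨xc, xc_mem_PiYdd⟩, (Subgroup.mem_subgroupOf).mpr xc_mem_L, rfl⟩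
  rw [h, autEnv_swapBC_sAlg_xc] at hx
  exact xb_not_mem_L (mem_of_sAlg_mem_algImage xb_mem_PiYdd hx)

/-! ## §2. The schema refutations (universal closures over the lawless interface are FALSE) -/

/-- **F-0620 `Cor218_i` is a schema**: at the toy, the topological automorphism `id × swap(a,b)` of
`Π^tp_X` does not preserve `Π^tp_Ÿ = {a = 0}` (clause 2 of Cor. 2.18 (i) as typed).
[cite: MochizukiEtTh2009, Cor 2.18(i) p.60] -/
theorem not_forall_cor218_i : ¬ ∀ (N : ℕ+) (l : ℕ) (R : RigidData.{0} N l), R.Cor218_i := by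
  intro h
  have h2 := (h 1 1 (toy 1) (autP swapAB)).2.1
  have hmem : autP swapAB xb ∈ (toy 1).PiYdd.map (autP swapAB).toMulEquiv.toMonoidHom :=
    Subgroup.mem_map_of_mem _ xb_mem_PiYdd
  rw [h2] at hmem
  exact xa_not_mem_PiYdd hmem

/-- **F-0622 `Cor218_iii_PiX` is a schema** (temp-slimness is not an axiom of the interface): the toy
`Π^tp_X` is abelian and nontrivial. [cite: MochizukiEtTh2009, Cor 2.18(iii) p.61] -/
theorem not_forall_cor218_iii_PiX : ¬ ∀ (N : ℕ+) (l : ℕ) (R : RigidData.{0} N l), R.Cor218_iii_PiX :=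
  fun h => xa_ne_one (h 1 1 (toy 1) xa fun y => by
    change xa * (y : P) * xa⁻¹ = y
    rw [mul_comm xa, mul_inv_cancel_right])

/-- **F-0623 `Cor218_iii_quotient` is a schema**: at the toy the envelope is abelian, so the union of
the centralisers of its open subgroups is everything, while `Ker(Π[μ_1] ↠ Π) = 1`.
[cite: MochizukiEtTh2009, Cor 2.18(iii) p.61] -/
theorem not_forall_cor218_iii_quotient :
    ¬ ∀ (N : ℕ+) (l : ℕ) (R : RigidData.{0} N l), R.Cor218_iii_quotient := by
  intro h
  have hq : centralizerUnion (toy 1).env = _ := h 1 1 (toy 1)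
  rw [ker_proj_eq_bot] at hq
  have hx : (toy 1).toThetaEnvData.sAlg ⟨xc, xc_mem_PiYdd⟩ ∈ centralizerUnion (toy 1).env :=
    ⟨⊤, by simp, Subgroup.mem_centralizer_iff.mpr fun y _ => env_mul_comm _ _ _ _⟩
  rw [hq, Subgroup.mem_bot] at hx
  exact sAlg_ne_one xc_mem_PiYdd xc_ne_one hx

/-- **F-0625 `Cor218_iv_surjective` is a schema**: the automorphism `id × swap(a,b)` of the toy
`Π^tp_X` preserves `Π^tp_Y` but moves `Π^tp_Ÿ`, so no automorphism of the model environment (which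
preserves `Im s^Θ_Ÿ ≅ Π^tp_Ÿ`) induces it. [cite: MochizukiEtTh2009, Cor 2.18(iv) p.61] -/
theorem not_forall_cor218_iv_surjective :
    ¬ ∀ (N : ℕ+) (l : ℕ) (R : RigidData.{0} N l), R.Cor218_iv_surjective := by
  intro h
  obtain ⟨α, hα⟩ := h 1 1 (toy 1) 1 (one_mem_thetaCocycles 1) (autP swapAB) (map_autP_PiY swapAB)
  have hS := α.map_sTheta
  change (fun H => H.map α.e.toMulEquiv.toMonoidHom) ''
      CycEnvelope.muConjClass _ _ ((toy 1).toThetaEnvData.sTheta (one_mem_thetaCocycles 1)).range =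
    CycEnvelope.muConjClass _ _ ((toy 1).toThetaEnvData.sTheta (one_mem_thetaCocycles 1)).range at hS
  rw [muConjClass_eq_singleton, Set.image_singleton, Set.singleton_eq_singleton_iff] at hS
  set x := (toy 1).toThetaEnvData.sTheta (one_mem_thetaCocycles 1) ⟨xb, xb_mem_PiYdd⟩ with hxdef
  have hx : α.e x ∈ ((toy 1).toThetaEnvData.sTheta (one_mem_thetaCocycles 1)).range.map
      α.e.toMulEquiv.toMonoidHom := Subgroup.mem_map_of_mem _ ⟨_, rfl⟩
  rw [hS] at hx
  obtain ⟨y, hy⟩ := hx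
  have h1 : (((CycEnvelope.proj _ _ (α.e x) : (toy 1).PiY)) : P) ∈ PiYdd := by
    rw [← hy]
    exact y.2
  rw [hα x] at h1
  exact xa_not_mem_PiYdd h1

/-- **F-0626 `Cor219_i_splittings` is a schema** (cyclotomic rigidity is not a consequence of the
bookkeeping axioms): the model automorphism `isoBC` moves `s^alg(l·Δ_Θ) = s^alg(c`-axis`)` to the
`b`-axis. [cite: MochizukiEtTh2009, Cor 2.19(i) p.64] -/
theorem not_forall_cor219_i_splittings :
    ¬ ∀ (N : ℕ+) (l : ℕ) (R : RigidData.{0} N l), R.Cor219_i_splittings := by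
  intro h
  obtain ⟨α, hα⟩ := exists_isoBC
  have h1 := (h 1 1 (toy 1) 1 (one_mem_thetaCocycles 1) α).1
  rw [hα] at h1
  exact map_autEnv_swapBC_algImage_L_ne h1

/-- **F-0627 `Cor219_i_subquotients` is a schema**: clause 2 (invariance of `μ_N · s^alg(l·Δ_Θ)`)
fails at the toy for `isoBC`, since `μ_1 = 1`. [cite: MochizukiEtTh2009, Cor 2.19(i) p.64] -/
theorem not_forall_cor219_i_subquotients :
    ¬ ∀ (N : ℕ+) (l : ℕ) (R : RigidData.{0} N l), R.Cor219_i_subquotients := by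
  intro h
  obtain ⟨α, hα⟩ := exists_isoBC
  have h2 := (h 1 1 (toy 1) 1 (one_mem_thetaCocycles 1) α).2.1
  rw [ker_proj_eq_bot, sup_bot_eq, hα] at h2
  exact map_autEnv_swapBC_algImage_L_ne h2

/-- **F-1920 `Prop212_i` is a schema**: the toy `Π^tp_X` is abelian, so `[Δ_X, Δ_X] · Ker = 1`, while
`(l·Δ_Θ) ≠ 1`. [cite: MochizukiEtTh2009, Prop 2.12(i) p.45] -/
theorem not_forall_prop212_i : ¬ ∀ (N : ℕ+) (l : ℕ) (R : RigidData.{0} N l), R.Prop212_i := by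
  intro h
  have hle : (toy 1).lDeltaTheta ≤ _ := h 1 1 (toy 1)
  have hcomm : ⁅(toy 1).aug.ker, (toy 1).aug.ker⁆ = ⊥ :=
    (Subgroup.commutator_eq_bot_iff_le_centralizer).mpr fun x _ =>
      Subgroup.mem_centralizer_iff.mpr fun y _ => mul_comm y x
  rw [hcomm, bot_sup_eq] at hle
  exact xc_ne_one ((Subgroup.mem_bot).mp (hle xc_mem_L))

/-- **F-0630 `Prop212_ii` is a schema**: in the (abelian) envelope `Π^tp_X[μ_1]` of the toy the
left-hand side of Prop. 2.12 (ii) is trivial while `s^alg(l·Δ_Θ) ≠ 1`.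
[cite: MochizukiEtTh2009, Prop 2.12(ii) p.45] -/
theorem not_forall_prop212_ii : ¬ ∀ (N : ℕ+) (l : ℕ) (R : RigidData.{0} N l), R.Prop212_ii := by
  intro h
  have heq := h 1 1 (toy 1)
  change (_ ⊔ (⊥ : Subgroup P).map _) ⊓ _ = (toy 1).lDeltaTheta.map _ at heq
  have hcomm : ⁅CycEnvelope.deltaEnv (toy 1).aug (toy 1).chi,
      CycEnvelope.deltaEnv (toy 1).aug (toy 1).chi⁆ = ⊥ :=
    (Subgroup.commutator_eq_bot_iff_le_centralizer).mpr fun x _ =>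
      Subgroup.mem_centralizer_iff.mpr fun y _ => env_mul_comm _ _ y x
  rw [hcomm, Subgroup.map_bot, bot_sup_eq, bot_inf_eq] at heq
  have hx : CycEnvelope.algSection (toy 1).aug (toy 1).chi xc ∈ (toy 1).lDeltaTheta.map
      (CycEnvelope.algSection (toy 1).aug (toy 1).chi) := Subgroup.mem_map_of_mem _ xc_mem_L
  rw [← heq, Subgroup.mem_bot] at hx
  exact xc_ne_one (by simpa using congrArg SemidirectProduct.right hx)

/-- **F-0631 `Prop214_i` is a schema**: at the toy `D_Y = 1`, so every `γ` of Prop. 2.14 (i) is inner,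
hence trivial (abelian envelope), and the left-hand side collapses to `s^alg(Ker) = 1 ∌ s^alg(xc)`.
[cite: MochizukiEtTh2009, Prop 2.14(i) p.49] -/
theorem not_forall_prop214_i : ¬ ∀ (N : ℕ+) (l : ℕ) (R : RigidData.{0} N l), R.Prop214_i := by
  intro h
  have hx := ((h 1 1 (toy 1)) ((toy 1).toThetaEnvData.sAlg ⟨xc, xc_mem_PiYdd⟩)).mpr
    ⟨⟨xc, xc_mem_PiYdd⟩, (Subgroup.mem_subgroupOf).mpr xc_mem_L, rfl⟩
  obtain ⟨γ, ⟨hc, hD, -⟩, β, -, k, hk, hx⟩ := hx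
  -- `γ` is inner, hence trivial
  have hγ : γ = 1 := by
    have hD' : TopOut.mk _ ⟨γ, hc⟩ ∈ (⊥ : Subgroup (TopOut (toy 1).env)) := by
      rw [← DY_eq_bot 1]; exact hD
    rw [Subgroup.mem_bot] at hD'
    have hD'' : (⟨γ, hc⟩ : contMulAut (toy 1).env) ∈ innerContAut (toy 1).env :=
      (QuotientGroup.eq_one_iff _).mp hD'
    obtain ⟨z, hz⟩ := Subgroup.mem_subgroupOf.mp hD''
    have hγ' : γ = MulAut.conj z := hz.symm
    rw [hγ']
    exact conj_env_eq_one _ _ z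
  -- `k ∈ s^alg(Ker) = 1`
  have hk' : k = 1 := by
    change k ∈ (toy 1).algImage ⊥ at hk
    rw [RigidData.algImage, Subgroup.bot_subgroupOf, Subgroup.map_bot, Subgroup.mem_bot] at hk
    exact hk
  rw [hγ, hk', MulAut.one_apply, mul_inv_cancel, one_mul] at hx
  exact sAlg_ne_one xc_mem_PiYdd xc_ne_one hx

/-- The cusp labels of the toy: `{⊥}` at `0`, nothing elsewhere; so no automorphism of `Π^tp_Y` acts
on the cusps by the translation `1`. [cite: MochizukiEtTh2009, Prop 2.14(iii) p.50] -/
theorem not_actsOnCuspsBy_one (l : ℕ) (a : (toy l).PiY ≃ₜ* (toy l).PiY) :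
    ¬ (toy l).ActsOnCuspsBy a 1 1 := by
  intro h
  have h0 := h 0
  simp at h0

/-- **F-0634 `Prop214_iii_mono` is a schema**: its surjectivity half demands an automorphism acting
on the cusp labels by the translation `l`; at the toy (with `l = 1`) no automorphism does.
[cite: MochizukiEtTh2009, Prop 2.14(iii) p.49] -/
theorem not_forall_prop214_iii_mono :
    ¬ ∀ (N : ℕ+) (l : ℕ) (R : RigidData.{0} N l), R.Prop214_iii_mono := by
  intro h
  obtain ⟨α, a, -, ha⟩ := (h 1 1 (toy 1) 1 (one_mem_thetaCocycles 1)).2 1 1 (by norm_num)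
  exact not_actsOnCuspsBy_one 1 a ha

/-- **F-0633 `Prop214_iii_bi` is a schema**: same obstruction with the translation `N·l = 1`.
[cite: MochizukiEtTh2009, Prop 2.14(iii) p.50] -/
theorem not_forall_prop214_iii_bi :
    ¬ ∀ (N : ℕ+) (l : ℕ) (R : RigidData.{0} N l), R.Prop214_iii_bi := by
  intro h
  obtain ⟨α, a, -, ha⟩ := (h 1 1 (toy 1) 1 (one_mem_thetaCocycles 1)).2 1 1 (by norm_num)
  exact not_actsOnCuspsBy_one 1 a ha

/-- **F-0619 `ActsOnCuspsBy` is a parametrised PREDICATE (vocabulary), not a fact**: its universal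
closure is false (the identity does not translate the toy's cusp labels by `1`).
[cite: MochizukiEtTh2009, Prop 2.14(iii) p.50] -/
theorem not_forall_actsOnCuspsBy :
    ¬ ∀ (N : ℕ+) (l : ℕ) (R : RigidData.{0} N l) (a : R.PiY ≃ₜ* R.PiY) (s : ℤ) (ε : ℤˣ),
      R.ActsOnCuspsBy a s ε :=
  fun h => not_actsOnCuspsBy_one 1 _ (h 1 1 (toy 1) (ContinuousMulEquiv.refl _) 1 1)

/-- **F-0628 `Induces` is a parametrised PREDICATE (vocabulary), not a fact**: the identity of the
envelope does not induce the nontrivial automorphism `swap(b,c)` of `Π^tp_Y`.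
[cite: MochizukiEtTh2009, Prop 2.14(iii) p.49] -/
theorem not_forall_induces :
    ¬ ∀ (N : ℕ+) (l : ℕ) (R : RigidData.{0} N l) (α : MulAut R.env) (a : R.PiY ≃ₜ* R.PiY),
      R.Induces α a := by
  intro h
  have hx := h 1 1 (toy 1) 1 (autYCont swapBC) ((toy 1).toThetaEnvData.sAlg ⟨xc, xc_mem_PiYdd⟩)
  have hx' := congrArg (fun y : (toy 1).PiY => (y : P)) hx
  exact xb_ne_xc hx'.symm

/-- **F-0629 `MuConj` is a parametrised PREDICATE (vocabulary), not a fact**: with `μ_1 = 1`,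
`μ`-conjugates coincide, and `autEnv swapBC ≠ 1`. [cite: MochizukiEtTh2009, Cor 2.18(iv) p.61] -/
theorem not_forall_muConj :
    ¬ ∀ (N : ℕ+) (l : ℕ) (R : RigidData.{0} N l) (α β : MulAut R.env), R.MuConj α β := by
  intro h
  obtain ⟨c, hc⟩ := h 1 1 (toy 1) 1 (autEnv swapBC).toMulEquiv
  rw [conj_env_eq_one, one_mul] at hc
  have hx := congrArg
    (fun φ : MulAut (toy 1).env => φ ((toy 1).toThetaEnvData.sAlg ⟨xc, xc_mem_PiYdd⟩)) hc
  simp only [MulAut.one_apply] at hx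
  change autEnv swapBC _ = _ at hx
  rw [autEnv_swapBC_sAlg_xc] at hx
  have h' := congrArg prP hx
  rw [prP_sAlg, prP_sAlg] at h'
  exact xb_ne_xc h'

end Toy

end RigidData

end Literature.AnabelianGeometry.EtaleTheta
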